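import Literature.MathematicalPhysics.QuantumFieldTheory.OSSkeletonAnalyticity
import Mathlib.MeasureTheory.Function.Jacobian
import Mathlib.Analysis.Calculus.BumpFunction.Normed
import Mathlib.Analysis.Calculus.BumpFunction.InnerProduct
import HarnessLib

/-!
# The density of the skeleton functional: pointwise analytic continuation of the skeleton Schwinger function

Topic `Literature/MathematicalPhysics/QuantumFieldTheory`; sequel of `OSSkeletonAnalyticity`, completing
the first stage of Osterwalder–Schrader II (Comm. Math. Phys. 42 (1975)), Ch. V, Method A for the
skeleton Schwinger function `𝒮` (fixed one-point profiles): the holomorphic function `F` on the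
`ℓ¹`-tube `{∑ᵢ |Im zᵢ| < π/2}` produced by the flat tube theorem (`exists_holomorphic_skelT`) is
identified **pointwise** on the real points,

  `F(x) = e^{-2b ∑ᵢ xᵢ²} 𝒮(w' + eˣ)`   (`skelDensity`),

so that `z ↦ F(z) e^{2b∑ zᵢ²}` is the analytic continuation of the skeleton Schwinger function in the
logarithmic gap variables `xᵢ = log(tᵢ - w')` to the tube over the `ℓ¹`-ball — Osterwalder–Schrader's
(5.8): "a function `S_k(ζ + u e)` analytic in `{w | ∑ |arg w| < π/2}` whose restriction to real
arguments defines the distribution" (`exists_holomorphic_extension_skelDensity`).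

* `integral_comp_exp_pi` — the substitution `uᵢ = e^{xᵢ}` on the positive orthant of `ℝᵐ`
  (Mathlib's change of variables `integral_image_eq_integral_abs_det_fderiv_smul`, the Jacobian
  `∏ e^{xᵢ}` by `LinearMap.det_pi`);
* `skelT_gaussian_mul_eq_integral_skelDensity` — `T(e^{-b·²}ϑ) = ∫ skelDensity(x) ∏ ϑᵢ(xᵢ) dx`;
* `eq_zero_of_forall_integral_mul_prod_schwartz_eq_zero` — a continuous function on `ℝᵐ`
  orthogonal to all products of one-variable Schwartz functions vanishes (product bump
  approximate identity);
* `exists_holomorphic_extension_skelDensity` — the pointwise theorem.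

## References

* K. Osterwalder, R. Schrader, *Axioms for Euclidean Green's functions II*, Comm. Math. Phys.
  42 (1975) 281–305, Ch. V pp. 291–292, (5.7)–(5.8). [OsterwalderSchraderCMP1975]
-/

noncomputable section

open MeasureTheory Set Filter Real
open _root_.Topology
open scoped InnerProductSpace NNReal ComplexConjugate SchwartzMap ContDiff

namespace Literature.MathematicalPhysics.QuantumFieldTheory

variable {d : ℕ} [NeZero d]

open Literature.MathematicalPhysics.QuantumLattice (SchwingerFamily IsPositiveTimeMulti)
open Literature.MathematicalPhysics.QuantumLattice.SchwingerFamily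

/-! ### The substitution `uᵢ = e^{xᵢ}` on the positive orthant -/

/-- The componentwise exponential `x ↦ (e^{xᵢ})ᵢ`. [folklore] -/
def expPi {m : ℕ} (x : Fin m → ℝ) : Fin m → ℝ := fun i => Real.exp (x i)

/-- The derivative of the componentwise exponential: the diagonal map `v ↦ (e^{xᵢ} vᵢ)ᵢ`. [folklore] -/
def expPiDeriv {m : ℕ} (x : Fin m → ℝ) : (Fin m → ℝ) →L[ℝ] (Fin m → ℝ) :=
  ContinuousLinearMap.pi fun i => Real.exp (x i) • ContinuousLinearMap.proj i

/-- `expPi` is differentiable with derivative `expPiDeriv`. [folklore] -/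
theorem hasFDerivAt_expPi {m : ℕ} (x : Fin m → ℝ) : HasFDerivAt expPi (expPiDeriv x) x :=
  hasFDerivAt_pi.2 fun i => (Real.hasDerivAt_exp (x i)).comp_hasFDerivAt x (hasFDerivAt_apply i x)

/-- `expPi` is injective. [folklore] -/
theorem injective_expPi {m : ℕ} : Function.Injective (expPi (m := m)) := fun _ _ h =>
  funext fun i => Real.exp_injective (congrFun h i)

/-- The image of `expPi` is the open positive orthant. [folklore] -/
theorem range_expPi {m : ℕ} : range (expPi (m := m)) = Set.pi univ fun _ => Ioi (0 : ℝ) := by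
  ext u
  constructor
  · rintro ⟨x, rfl⟩ i -
    exact Real.exp_pos _
  · intro hu
    refine ⟨fun i => Real.log (u i), funext fun i => ?_⟩
    exact Real.exp_log (hu i (mem_univ _))

/-- **The Jacobian of the componentwise exponential**: `det expPiDeriv x = ∏ᵢ e^{xᵢ}`. [folklore] -/
theorem det_expPiDeriv {m : ℕ} (x : Fin m → ℝ) : (expPiDeriv x).det = ∏ i, Real.exp (x i) := by
  have h : ((expPiDeriv x : (Fin m → ℝ) →L[ℝ] (Fin m → ℝ)) : (Fin m → ℝ) →ₗ[ℝ] (Fin m → ℝ)) =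
      LinearMap.pi fun i => (Real.exp (x i) • LinearMap.id : ℝ →ₗ[ℝ] ℝ).comp (LinearMap.proj i) := by
    apply LinearMap.ext
    intro v
    funext i
    simp [expPiDeriv]
  rw [ContinuousLinearMap.det, h, LinearMap.det_pi]
  refine Finset.prod_congr rfl fun i _ => ?_
  rw [LinearMap.det_smul, LinearMap.det_id, Module.finrank_self]
  simp

/-- **The substitution `uᵢ = e^{xᵢ}`**: `∫_{(0,∞)ᵐ} g(u) du = ∫_{ℝᵐ} (∏ᵢ e^{xᵢ}) g(eˣ) dx`. [folklore] -/
theorem integral_comp_exp_pi {m : ℕ} (g : (Fin m → ℝ) → ℂ) :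
    ∫ u in Set.pi univ (fun _ => Ioi (0 : ℝ)), g u =
      ∫ x : Fin m → ℝ, (∏ i, Real.exp (x i)) • g (expPi x) := by
  have h := integral_image_eq_integral_abs_det_fderiv_smul (μ := (volume : Measure (Fin m → ℝ)))
    MeasurableSet.univ (fun x _ => (hasFDerivAt_expPi x).hasFDerivWithinAt) injective_expPi.injOn g
  rw [image_univ, range_expPi, Measure.restrict_univ] at h
  rw [h]
  refine integral_congr_ae (Eventually.of_forall fun x => ?_)
  beta_reduce
  rw [det_expPiDeriv, abs_of_pos (Finset.prod_pos fun i _ => Real.exp_pos _)]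

/-! ### The density of the skeleton functional -/

section Density

variable (𝔖 : SchwingerFamily (EuclideanSpace ℝ (Fin d))) {k : ℕ}
  (φ : Fin (k + 2) → 𝓢(EuclideanSpace ℝ (Fin d), ℂ)) (w' b : ℝ)

/-- The **skeleton density** in the logarithmic gap variables:
`skelDensity x = e^{-2b∑ᵢ xᵢ²} 𝒮(w' + eˣ)`. [folklore] -/
def skelDensity (x : Fin (k + 1) → ℝ) : ℂ :=
  Complex.exp (-(2 * b : ℂ) * ∑ i, (x i : ℂ) ^ 2) * skelS' 𝔖 φ w' (expPi x)

variable {𝔖 φ w' b}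

/-- Continuity of the skeleton density. [folklore] -/
theorem continuous_skelDensity : Continuous (skelDensity 𝔖 φ w' b) := by
  unfold skelDensity
  refine (Complex.continuous_exp.comp (continuous_const.mul (continuous_finsetSum _ fun i _ =>
    ((Complex.continuous_ofReal.comp (continuous_apply i)).pow 2)))).mul ?_
  exact continuous_skelS'.comp (continuous_pi fun i => Real.continuous_exp.comp (continuous_apply i))

/-- **The skeleton functional at windowed Schwartz profiles is the integral of the skeleton
density**: `T(e^{-b·²}ϑ₀, …) = ∫ skelDensity(x) ∏ᵢ ϑᵢ(xᵢ) dx` (the product weight vanishes off the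
positive orthant; substitute `uᵢ = e^{xᵢ}`). [folklore] -/
theorem skelT_gaussian_mul_eq_integral_skelDensity (ϑ : Fin (k + 1) → 𝓢(ℝ, ℂ)) :
    skelT 𝔖 φ w' b (fun j (s : ℝ) => Complex.exp (-(b : ℂ) * (s : ℂ) ^ 2) * ϑ j s) =
      ∫ x : Fin (k + 1) → ℝ, skelDensity 𝔖 φ w' b x * ∏ j, ϑ j (x j) := by
  rw [skelT]
  -- restrict to the positive orthant
  have h1 : ∫ u : Fin (k + 1) → ℝ, wprod b (fun j (s : ℝ) => Complex.exp (-(b : ℂ) * (s : ℂ) ^ 2) * ϑ j s) u *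
      skelS' 𝔖 φ w' u = ∫ u in Set.pi univ (fun _ => Ioi (0 : ℝ)),
        wprod b (fun j (s : ℝ) => Complex.exp (-(b : ℂ) * (s : ℂ) ^ 2) * ϑ j s) u * skelS' 𝔖 φ w' u := by
    refine (setIntegral_eq_integral_of_forall_compl_eq_zero fun u hu => ?_).symm
    have hu' : ∃ i, u i ≤ 0 := by
      by_contra h
      push Not at h
      exact hu fun i _ => h i
    obtain ⟨i, hi⟩ := hu'
    rw [wprod, Finset.prod_eq_zero (Finset.mem_univ i) (logW_of_nonpos hi), zero_mul]
  rw [h1, integral_comp_exp_pi]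
  refine integral_congr_ae (Eventually.of_forall fun x => ?_)
  -- pointwise algebra at `u = eˣ`
  simp only [skelDensity, wprod, expPi, logW_exp, Complex.real_smul, Complex.ofReal_prod,
    Complex.ofReal_exp]
  have hfac : ∀ i, Complex.exp (x i : ℂ) * (Complex.exp (-(b : ℂ) * (x i : ℂ) ^ 2) *
      (Complex.exp (-(b : ℂ) * (x i : ℂ) ^ 2) * ϑ i (x i)) / Complex.exp (x i : ℂ)) =
      Complex.exp (-(2 * b : ℂ) * (x i : ℂ) ^ 2) * ϑ i (x i) := by
    intro i
    have hne : Complex.exp (x i : ℂ) ≠ 0 := Complex.exp_ne_zero _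
    have h2 : Complex.exp (-(2 * b : ℂ) * (x i : ℂ) ^ 2) =
        Complex.exp (-(b : ℂ) * (x i : ℂ) ^ 2) * Complex.exp (-(b : ℂ) * (x i : ℂ) ^ 2) := by
      rw [← Complex.exp_add]; congr 1; ring
    rw [h2]
    field_simp
  calc (∏ i, Complex.exp (x i : ℂ)) * ((∏ i, Complex.exp (-(b : ℂ) * (x i : ℂ) ^ 2) *
        (Complex.exp (-(b : ℂ) * (x i : ℂ) ^ 2) * ϑ i (x i)) / Complex.exp (x i : ℂ)) *
        skelS' 𝔖 φ w' fun i => Real.exp (x i))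
      = (∏ i, Complex.exp (x i : ℂ) * (Complex.exp (-(b : ℂ) * (x i : ℂ) ^ 2) *
        (Complex.exp (-(b : ℂ) * (x i : ℂ) ^ 2) * ϑ i (x i)) / Complex.exp (x i : ℂ))) *
        skelS' 𝔖 φ w' fun i => Real.exp (x i) := by rw [Finset.prod_mul_distrib]; ring
    _ = (∏ i, Complex.exp (-(2 * b : ℂ) * (x i : ℂ) ^ 2) * ϑ i (x i)) * skelS' 𝔖 φ w' fun i => Real.exp (x i) := by
        simp_rw [hfac]
    _ = Complex.exp (-(2 * b : ℂ) * ∑ i, (x i : ℂ) ^ 2) * (skelS' 𝔖 φ w' fun i => Real.exp (x i)) *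
        ∏ j, ϑ j (x j) := by
        rw [Finset.prod_mul_distrib, Finset.mul_sum, Complex.exp_sum]; ring

end Density

/-! ### Products of one-variable Schwartz functions separate continuous functions -/

/-- A translated normalised bump as a Schwartz function on `ℝ` with complex values. [folklore] -/
theorem exists_schwartz_bump (c δ : ℝ) (hδ : 0 < δ) :
    ∃ ρ : 𝓢(ℝ, ℂ), (∀ s, ∃ r : ℝ, 0 ≤ r ∧ ρ s = r) ∧ (∀ s, δ ≤ |s - c| → ρ s = 0) ∧
      ∫ s, ρ s = 1 := by
  let β : ContDiffBump c := ⟨δ / 2, δ, by linarith, by linarith⟩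
  set g : ℝ → ℝ := β.normed volume with hg
  have hgc : ContDiff ℝ ∞ fun s => ((g s : ℝ) : ℂ) := Complex.ofRealCLM.contDiff.comp β.contDiff_normed
  have hgs : HasCompactSupport fun s => ((g s : ℝ) : ℂ) :=
    β.hasCompactSupport_normed.comp_left Complex.ofReal_zero
  refine ⟨hgs.toSchwartzMap hgc, fun s => ⟨g s, β.nonneg_normed s, rfl⟩, fun s hs => ?_, ?_⟩
  · show ((g s : ℝ) : ℂ) = 0
    have h : s ∉ Function.support g := by
      rw [hg, β.support_normed_eq, Metric.mem_ball, Real.dist_eq, not_lt]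
      exact hs
    rw [Function.notMem_support] at h
    rw [h, Complex.ofReal_zero]
  · show ∫ s, ((g s : ℝ) : ℂ) = 1
    rw [integral_complex_ofReal, hg, β.integral_normed, Complex.ofReal_one]

/-- **A continuous function on `ℝᵐ` orthogonal to all products of one-variable Schwartz functions
vanishes** (test against products of translated normalised bumps, an approximate identity). [folklore] -/
theorem eq_zero_of_forall_integral_mul_prod_schwartz_eq_zero {m : ℕ} {D : (Fin m → ℝ) → ℂ}
    (hD : Continuous D) (h : ∀ ϑ : Fin m → 𝓢(ℝ, ℂ), ∫ x : Fin m → ℝ, D x * ∏ i, ϑ i (x i) = 0)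
    (x₀ : Fin m → ℝ) : D x₀ = 0 := by
  rw [← norm_le_zero_iff]
  refine le_of_forall_pos_le_add fun ε hε => ?_
  rw [zero_add]
  -- continuity modulus
  obtain ⟨δ, hδ, hcont⟩ := Metric.continuous_iff.1 hD x₀ ε hε
  -- bumps in each coordinate
  choose ρ hρnn hρsupp hρint using fun i => exists_schwartz_bump (x₀ i) δ hδ
  set P : (Fin m → ℝ) → ℂ := fun x => ∏ i, ρ i (x i) with hP
  have hPreal : ∀ x, ∃ r : ℝ, 0 ≤ r ∧ P x = r := by
    intro x
    choose r hr0 hr using fun i => hρnn i (x i)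
    refine ⟨∏ i, r i, Finset.prod_nonneg fun i _ => hr0 i, ?_⟩
    simp only [hP, hr, Complex.ofReal_prod]
  have hPzero : ∀ x, δ ≤ dist x x₀ → P x = 0 := by
    intro x hx
    obtain ⟨i, hi⟩ : ∃ i, δ ≤ |x i - x₀ i| := by
      by_contra hcon
      push Not at hcon
      have : dist x x₀ < δ := by
        rw [dist_pi_lt_iff hδ]
        intro i
        rw [Real.dist_eq]
        exact hcon i
      linarith
    exact Finset.prod_eq_zero (Finset.mem_univ i) (hρsupp i (x i) hi)
  have hPint : ∫ x : Fin m → ℝ, P x = 1 := by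
    simp only [hP]
    rw [integral_fintype_prod_volume_eq_prod (𝕜 := ℂ) (fun i (s : ℝ) => ρ i s)]
    exact Finset.prod_eq_one fun i _ => hρint i
  have hPcs : HasCompactSupport P := by
    refine HasCompactSupport.intro (isCompact_closedBall x₀ δ) fun x hx => hPzero x ?_
    rw [Metric.mem_closedBall, not_le] at hx
    exact hx.le
  have hPc : Continuous P := continuous_finsetProd _ fun i _ => (ρ i).continuous.comp (continuous_apply i)
  have hPi : Integrable P := hPc.integrable_of_hasCompactSupport hPcs
  -- `D x₀ = ∫ (D x₀ - D x) P x dx`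
  have hrepr : D x₀ = ∫ x, (D x₀ - D x) * P x := by
    have h2 : ∫ x, (D x₀ - D x) * P x = (∫ x, D x₀ * P x) - ∫ x, D x * P x := by
      simp_rw [sub_mul]
      exact integral_sub (hPi.const_mul _) ((hD.mul hPc).integrable_of_hasCompactSupport hPcs.mul_left)
    rw [h2, h ρ, sub_zero, integral_const_mul, hPint, mul_one]
  rw [hrepr]
  refine (norm_integral_le_integral_norm _).trans ?_
  have hbound : ∀ x, ‖(D x₀ - D x) * P x‖ ≤ ε * ‖P x‖ := by
    intro x
    rw [norm_mul]
    by_cases hx : dist x x₀ < δ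
    · exact mul_le_mul_of_nonneg_right (by rw [norm_sub_rev, ← dist_eq_norm]; exact (hcont x hx).le) (norm_nonneg _)
    · rw [hPzero x (not_lt.1 hx), norm_zero, mul_zero, mul_zero]
  refine (integral_mono_of_nonneg (Eventually.of_forall fun x => norm_nonneg _) (hPi.norm.const_mul ε)
    (Eventually.of_forall hbound)).trans ?_
  rw [integral_const_mul]
  have hnorm : ∫ x, ‖P x‖ = 1 := by
    have h3 : (fun x => ‖P x‖) = fun x => (P x).re := by
      funext x
      obtain ⟨r, hr0, hr⟩ := hPreal x
      rw [hr, Complex.norm_real, Real.norm_eq_abs, abs_of_nonneg hr0, Complex.ofReal_re]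
    rw [h3, ← RCLike.re_eq_complex_re]
    have h4 := integral_re hPi
    simp only [RCLike.re_eq_complex_re] at h4 ⊢
    rw [h4, hPint, Complex.one_re]
  rw [hnorm, mul_one]

/-! ### The pointwise theorem -/

section Main

variable (𝔖 : SchwingerFamily (EuclideanSpace ℝ (Fin d))) {k : ℕ}
  (φ : Fin (k + 2) → 𝓢(EuclideanSpace ℝ (Fin d), ℂ)) {w' r : ℝ} (hr : 0 ≤ r) {b : ℝ} (hb : 0 < b)

include hr hb

/-- **Analytic continuation of the skeleton Schwinger function to the tube over the `ℓ¹`-ball**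
(Osterwalder–Schrader II, Ch. V, (5.7)–(5.8), Method A, for fixed profiles): there is `F`
holomorphic on `{∑ᵢ |Im zᵢ| < π/2}`, bounded on every closed sub-tube, whose values at the real
points are `F(x) = e^{-2b∑xᵢ²} 𝔖_{k+2}(⊗ⱼ φⱼ(· - aⱼ(w' + eˣ) e₀))` — so that `F(z) e^{2b∑zᵢ²}`
continues the skeleton Schwinger function in the logarithmic gap variables to
`{∑ᵢ |arg(tᵢ - w')| < π/2}`. [cite: OsterwalderSchraderCMP1975, Ch. V eqs. (5.7)–(5.8)] -/
theorem exists_holomorphic_extension_skelDensity (hE1 : 𝔖.IsEuclideanCovariant)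
    (hE2 : 𝔖.IsOSReflectionPositive)
    (hφ : ∀ j, tsupport (φ j : EuclideanSpace ℝ (Fin d) → ℂ) ⊆ {y | |y 0| ≤ r}) (hw : 2 * r < w')
    (hw0 : 0 ≤ w') :
    ∃ F : (Fin (k + 1) → ℂ) → ℂ,
      DifferentiableOn ℂ F {z : Fin (k + 1) → ℂ | ∑ j, |(z j).im| < π / 2} ∧
      (∀ c : ℝ, c < π / 2 → ∃ K : ℝ, ∀ z : Fin (k + 1) → ℂ, ∑ j, |(z j).im| ≤ c → ‖F z‖ ≤ K) ∧
      ∀ x : Fin (k + 1) → ℝ, F (fun j => (x j : ℂ)) = skelDensity 𝔖 φ w' b x := by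
  obtain ⟨F, hF, hK, hT⟩ := exists_holomorphic_skelT 𝔖 φ hr hb hE1 hE2 hφ hw hw0
  refine ⟨F, hF, hK, fun x₀ => ?_⟩
  -- the real embedding lands in the tube
  set ι : (Fin (k + 1) → ℝ) → (Fin (k + 1) → ℂ) := fun x j => (x j : ℂ) with hι
  have hιc : Continuous ι := continuous_pi fun j => Complex.continuous_ofReal.comp (continuous_apply j)
  have hιmem : ∀ x, ι x ∈ {z : Fin (k + 1) → ℂ | ∑ j, |(z j).im| < π / 2} := fun x => by
    simp only [hι, mem_setOf_eq, Complex.ofReal_im, abs_zero, Finset.sum_const_zero]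
    positivity
  have hFc : Continuous fun x => F (ι x) := hF.continuousOn.comp_continuous hιc hιmem
  -- `F ∘ ι` is bounded, `skelDensity` is bounded
  obtain ⟨K, hK0⟩ := hK 0 (by positivity)
  have hFb : ∀ x, ‖F (ι x)‖ ≤ |K| * (1 + ‖x‖) ^ 0 := fun x => by
    rw [pow_zero, mul_one]
    refine (hK0 _ ?_).trans (le_abs_self K)
    simp [hι]
  obtain ⟨C, N, hC, hS⟩ := exists_norm_skelS'_le (𝔖 := 𝔖) (φ := φ) (w' := w')
  have hDb : ∀ x, ‖skelDensity 𝔖 φ w' b x‖ ≤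
      C * (2 : ℝ) ^ N * Real.exp (((N : ℝ)) ^ 2 / (4 * (2 * b))) * (1 + ‖x‖) ^ 0 := by
    intro x
    rw [pow_zero, mul_one, skelDensity, norm_mul, Complex.norm_exp]
    have hre : (-(2 * b : ℂ) * ∑ i, (x i : ℂ) ^ 2).re = -(2 * b) * ∑ i, (x i) ^ 2 := by
      have : (-(2 * b : ℂ) * ∑ i, (x i : ℂ) ^ 2) = ((-(2 * b) * ∑ i, (x i) ^ 2 : ℝ) : ℂ) := by
        push_cast; ring
      rw [this, Complex.ofReal_re]
    rw [hre]
    refine (mul_le_mul_of_nonneg_left (hS (expPi x)) (Real.exp_pos _).le).trans ?_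
    -- `‖expPi x‖ ≤ e^{‖x‖}` and `e^{-2b∑xᵢ²} ≤ e^{-2b‖x‖²}`
    have hE : ‖expPi x‖ ≤ Real.exp ‖x‖ := by
      refine (pi_norm_le_iff_of_nonneg (Real.exp_pos _).le).2 fun i => ?_
      rw [expPi, Real.norm_eq_abs, abs_of_pos (Real.exp_pos _)]
      exact Real.exp_le_exp.2 ((le_abs_self _).trans (by rw [← Real.norm_eq_abs]; exact norm_le_pi_norm x i))
    have hsum : ‖x‖ ^ 2 ≤ ∑ i, (x i) ^ 2 := by
      rcases isEmpty_or_nonempty (Fin (k + 1)) with h0 | h0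
      · exact (Fin.pos_iff_nonempty.1 (Nat.succ_pos k) |> fun h => (h0.false h.some)).elim
      · obtain ⟨i, -, hi⟩ := Finset.exists_max_image Finset.univ (fun i => |x i|) Finset.univ_nonempty
        have hxi : ‖x‖ ≤ |x i| := (pi_norm_le_iff_of_nonneg (abs_nonneg _)).2 fun j => by
          rw [Real.norm_eq_abs]; exact hi j (Finset.mem_univ j)
        calc ‖x‖ ^ 2 ≤ |x i| ^ 2 := pow_le_pow_left₀ (norm_nonneg _) hxi 2
          _ = x i ^ 2 := sq_abs _
          _ ≤ ∑ j, x j ^ 2 := Finset.single_le_sum (f := fun j => x j ^ 2) (fun j _ => sq_nonneg _)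
              (Finset.mem_univ i)
    have h1 : Real.exp (-(2 * b) * ∑ i, x i ^ 2) ≤ Real.exp (-(2 * b) * ‖x‖ ^ 2) :=
      Real.exp_le_exp.2 (by nlinarith)
    have h2 : (1 + ‖expPi x‖) ^ N ≤ (2 : ℝ) ^ N * Real.exp ((N : ℝ) * ‖x‖) := by
      have h3 : 1 + ‖expPi x‖ ≤ 2 * Real.exp ‖x‖ := by
        have := Real.one_le_exp (norm_nonneg x); linarith
      calc (1 + ‖expPi x‖) ^ N ≤ (2 * Real.exp ‖x‖) ^ N := pow_le_pow_left₀ (by positivity) h3 N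
        _ = (2 : ℝ) ^ N * Real.exp ((N : ℝ) * ‖x‖) := by
            rw [mul_pow, ← Real.exp_nat_mul]
    have h4 := exp_neg_mul_sq_mul_exp_le (by positivity : 0 < 2 * b) (N : ℝ) ‖x‖
    calc Real.exp (-(2 * b) * ∑ i, x i ^ 2) * (C * (1 + ‖expPi x‖) ^ N)
        ≤ Real.exp (-(2 * b) * ‖x‖ ^ 2) * (C * ((2 : ℝ) ^ N * Real.exp ((N : ℝ) * ‖x‖))) := by gcongr
      _ = C * (2 : ℝ) ^ N * (Real.exp (-(2 * b) * ‖x‖ ^ 2) * Real.exp ((N : ℝ) * ‖x‖)) := by ring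
      _ ≤ C * (2 : ℝ) ^ N * Real.exp ((N : ℝ) ^ 2 / (4 * (2 * b))) := by gcongr
  -- the difference is orthogonal to all products of Schwartz functions
  have hdiff : ∀ ϑ : Fin (k + 1) → 𝓢(ℝ, ℂ),
      ∫ x : Fin (k + 1) → ℝ, (F (ι x) - skelDensity 𝔖 φ w' b x) * ∏ i, ϑ i (x i) = 0 := by
    intro ϑ
    have hi1 := Literature.Analysis.Complex.integrable_mul_prod_schwartz hFc hFb ϑ
    have hi2 := Literature.Analysis.Complex.integrable_mul_prod_schwartz continuous_skelDensity hDb ϑ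
    simp_rw [sub_mul]
    rw [integral_sub hi1 hi2, ← hT ϑ, skelT_gaussian_mul_eq_integral_skelDensity, sub_self]
  have h := eq_zero_of_forall_integral_mul_prod_schwartz_eq_zero (hFc.sub continuous_skelDensity) hdiff x₀
  exact sub_eq_zero.1 h

end Main

end Literature.MathematicalPhysics.QuantumFieldTheory
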